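import Summits.RiemannHypothesis.RiemannHypothesis.Theses.SignCone
import Summits.RiemannHypothesis.RiemannHypothesis.Theorems.SignConeOscillatory.Negative.WithoutPD

/-!
# `OscSingleWindow` (crux stmt-RiemannHypothesis-18012) — negative lemma: positive-definiteness stays
# load-bearing inside the single-window class
(route `SignCone`; crux-disprover record of seat `refuter-cdisprove-stmt-RiemannHypothesis-18012-0`, cycle 1;
`--supports` — it closes nothing)

The crux `Summit.RiemannHypothesis.RiemannHypothesis.Theses.SignCone.OscSingleWindow` is the unit-slack sign-cone
inequality `-Re F(0) ≤ Re W_ar(F)` for node-nonnegative AUTOCORRELATION SUMS `F = Σᵢ gᵢ ⋆ g̃ᵢ` whose far-field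
negativity is confined to ONE window `T ≤ |t| ≤ T + log 2`, `T ≥ 3`.  The parent crux's lemma
`SignConeOscillatory.Negative.signConeOscillatory_false_without_PD` (p130023) shows that the cone structure cannot be
weakened to "smooth, compactly supported in `[-2a, 2a]`, hermitian" — but its witness dips at height `9/10 < 3`, i.e.
it is NOT in the single-window class, so it says nothing about this item.  Here the same mutation is refuted INSIDE
the class:

* `oscSingleWindow_false_without_PD` — replace "`F = Σᵢ gᵢ ⋆ g̃ᵢ`, `supp gᵢ ⊆ [-a, a]`" by "`F` smooth, compactly
  supported in `[-2a, 2a]`, hermitian", keeping the node hypothesis, the single-window hypothesis (`T ≥ 3`), the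
  oscillation hypothesis and the conclusion VERBATIM: FALSE.
  Witness (`a = c`, `c = 5 log 2 + 1/66`): `F = -(φ(· - c) + φ(· + c))`, `φ = WeilContinuous.moll 131` (radius
  `1/132`): `F` vanishes at `0` and at every node (`log 32 = 5 log 2 = c - 1/66`, `log 33 ≥ c + 1/66`, from
  `OscSingleWindow.Negative.Threshold`, inlined), its negativity sits in `(c - 1/132, c + 1/132) ⊆ [5 log 2, 6 log 2]`
  (one window, `T = 5 log 2 ≥ 3`), `Re F(c) < 0`; and in Bombieri's form of the archimedean term
  (`weilArchTermBombieri_eq_weilArchTerm_holds`) `Re W_ar(F) = ∫ F·(e^{-t/2} + e^{t/2}) + ∫₀^∞ e^{t/2} φ(t - c)/sinh t dt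
  ≤ -4 + e²/3 < 0 = -Re F(0)` (`sinh t ≥ t ≥ 3` and `e^{t/2} ≤ e²` on the dip).
* `oscSingleWindow_false_without_PD_anySlack` — the same for EVERY constant slack `-C·Re F(0)` (`F(0) = 0`).
* `negHighTwoBump_witness` — the witness packaged (all kept hypotheses, `F 0 = 0`, `Re W_ar(F) < 0`).

Reading for provers: in the single high window, as in the whole oscillatory class, hermitian symmetry + smoothness +
support + node signs + window geometry do not control the polar term of a between-node dip; the dip is FREE in
Bombieri's position-space form (no width penalty appears without `F̂ ≥ 0`).  Any proof must charge the dip to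
positive-definiteness — the "completion cost" of the crux's informal mechanism is exactly that charge.
-/

noncomputable section

-- `Summit.RiemannHypothesis.RiemannHypothesis.…` repeats a namespace component by design (D-0017 layout).
set_option linter.dupNamespace false

open scoped BigOperators ComplexConjugate Topology
open Complex MeasureTheory Set Filter

namespace Summit.RiemannHypothesis.RiemannHypothesis.Theorems.OscSingleWindow.Negative

open Literature.NumberTheory.LFunctions
open Summit.RiemannHypothesis.RiemannHypothesis.Theorems.SignCone
open Summit.RiemannHypothesis.RiemannHypothesis.Theorems.SignConeOscillatory.Negative

/-! ## The bump `φ = moll 131` (radius `1/132`) and the dip centre `c = 5 log 2 + 1/66` -/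

/-- `rOut (bump 131) = 1/132`. [folklore] -/
theorem bump131_rOut : (WeilContinuous.bump 131).rOut = 1 / 132 := by
  rw [WeilContinuous.bump_rOut]; norm_num

/-- `φ(x) = 0` for `|x| ≥ 1/132`. [folklore] -/
theorem moll131_eq_zero {x : ℝ} (hx : 1 / 132 ≤ |x|) : WeilContinuous.moll 131 x = 0 :=
  WeilContinuous.moll_eq_zero (by rwa [bump131_rOut])

/-- Decimal window for the dip centre: `3 + 1/132 + 1/3 ≤ 5 log 2` and `5 log 2 + 1/66 + 1/132 ≤ 4`. [folklore] -/
theorem five_log_two_bounds : (3 : ℝ) + 1 / 132 + 1 / 3 ≤ 5 * Real.log 2 ∧ 5 * Real.log 2 + 1 / 66 + 1 / 132 ≤ 4 := by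
  constructor <;> linarith [Real.log_two_gt_d9, Real.log_two_lt_d9]

/-- The high dip vanishes unless `|u - c| < 1/132`: for `|u| ≤ 5 log 2 + 1/132` or `|u| ≥ 5 log 2 + 3/132` the
witness is `0`. [folklore] -/
theorem negHighTwoBump_eq_zero {u : ℝ}
    (hu : |u| ≤ 5 * Real.log 2 + 1 / 132 ∨ 5 * Real.log 2 + 3 / 132 ≤ |u|) :
    -(WeilContinuous.moll 131 (u - (5 * Real.log 2 + 1 / 66)) +
      WeilContinuous.moll 131 (u + (5 * Real.log 2 + 1 / 66))) = 0 := by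
  have hl := five_log_two_bounds
  have h1 : 1 / 132 ≤ |u - (5 * Real.log 2 + 1 / 66)| := by
    rcases hu with hu | hu
    · rcases le_or_gt 0 u with hu0 | hu0
      · rw [abs_of_nonneg hu0] at hu; rw [abs_of_nonpos (by linarith)]; linarith
      · rw [abs_of_neg hu0] at hu; rw [abs_of_nonpos (by linarith)]; linarith
    · rcases le_or_gt 0 u with hu0 | hu0
      · rw [abs_of_nonneg hu0] at hu; rw [abs_of_nonneg (by linarith)]; linarith
      · rw [abs_of_neg hu0] at hu; rw [abs_of_nonpos (by linarith)]; linarith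
  have h2 : 1 / 132 ≤ |u + (5 * Real.log 2 + 1 / 66)| := by
    rcases hu with hu | hu
    · rcases le_or_gt 0 u with hu0 | hu0
      · rw [abs_of_nonneg hu0] at hu; rw [abs_of_nonneg (by linarith)]; linarith
      · rw [abs_of_neg hu0] at hu; rw [abs_of_nonneg (by linarith)]; linarith
    · rcases le_or_gt 0 u with hu0 | hu0
      · rw [abs_of_nonneg hu0] at hu; rw [abs_of_nonneg (by linarith)]; linarith
      · rw [abs_of_neg hu0] at hu; rw [abs_of_neg (by linarith)]; linarith
  rw [moll131_eq_zero h1, moll131_eq_zero h2, add_zero, neg_zero]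

/-- The witness vanishes at every node `log n`, `n ≥ 2` (`log 32 = 5 log 2`, `log 33 ≥ 5 log 2 + 1/33`). [folklore] -/
theorem negHighTwoBump_log_nat_eq_zero {n : ℕ} (hn : 2 ≤ n) :
    -(WeilContinuous.moll 131 (Real.log n - (5 * Real.log 2 + 1 / 66)) +
      WeilContinuous.moll 131 (Real.log n + (5 * Real.log 2 + 1 / 66))) = 0 := by
  -- `log 32 = 5 log 2` and `5 log 2 + 1/33 ≤ log 33` (as in `Negative.Threshold`, inlined to keep this file's imports
  -- to the parent lemma only)
  have log_thirtytwo : Real.log 32 = 5 * Real.log 2 := by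
    rw [show (32 : ℝ) = 2 ^ 5 by norm_num, Real.log_pow]
    push_cast
    ring
  have log_thirtythree_ge : 5 * Real.log 2 + 1 / 33 ≤ Real.log 33 := by
    have h := Real.one_sub_inv_le_log_of_pos (x := (33 : ℝ) / 32) (by norm_num)
    rw [Real.log_div (by norm_num) (by norm_num), log_thirtytwo] at h
    norm_num at h ⊢
    linarith
  have hn' : (2 : ℝ) ≤ n := by exact_mod_cast hn
  have hlog2n : Real.log 2 ≤ Real.log n := Real.log_le_log (by norm_num) hn'
  have hlog2 : 0 < Real.log 2 := Real.log_pos (by norm_num)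
  refine negHighTwoBump_eq_zero ?_
  rw [abs_of_nonneg (by linarith)]
  rcases le_or_gt n 32 with h32 | h33
  · left
    have h32' : (n : ℝ) ≤ 32 := by exact_mod_cast h32
    have hlm : Real.log n ≤ 5 * Real.log 2 := by
      rw [← log_thirtytwo]
      exact Real.log_le_log (by linarith) h32'
    linarith
  · right
    have h33' : (33 : ℝ) ≤ n := by exact_mod_cast h33
    have hlm : Real.log 33 ≤ Real.log n := Real.log_le_log (by norm_num) h33'
    have h33log := log_thirtythree_ge
    linarith

/-! ## The witness, packaged -/

/-- **The high-dip witness satisfies every kept hypothesis and has `F(0) = 0`, `Re W_ar(F) < 0`.**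
`a = c = 5 log 2 + 1/66`, `F = -(φ(· - c) + φ(· + c))`, `φ = WeilContinuous.moll 131`: smooth, compactly supported in
`[-2a, 2a]`, hermitian, vanishing at every node, far-field negativity inside the single window `[5 log 2, 6 log 2]`,
negative at `c`; `F 0 = 0` and `Re W_ar(F) ≤ -4 + e²/3 < 0`. [folklore] -/
theorem negHighTwoBump_witness :
    ∃ (a : ℝ) (F : ℝ → ℂ), 0 < a ∧
      ((ContDiff ℝ ((⊤ : ℕ∞) : WithTop ℕ∞) F ∧ HasCompactSupport F) ∧ tsupport F ⊆ Set.Icc (-(2 * a)) (2 * a)) ∧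
      (∀ u : ℝ, F (-u) = (starRingEnd ℂ) (F u)) ∧
      (∀ n : ℕ, 2 ≤ n → 0 ≤ (F (Real.log n)).re) ∧
      (∃ T : ℝ, 3 ≤ T ∧ ∀ t : ℝ, Real.log 2 ≤ |t| → (F t).re < 0 → T ≤ |t| ∧ |t| ≤ T + Real.log 2) ∧
      (∃ t : ℝ, Real.log 2 ≤ |t| ∧ (F t).re < 0) ∧
      F 0 = 0 ∧ (weilPolarTerm F + weilArchTerm F).re < 0 := by
  have hl := five_log_two_bounds
  have hlog2 : 0 < Real.log 2 := Real.log_pos (by norm_num)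
  set c : ℝ := 5 * Real.log 2 + 1 / 66 with hc
  have hcpos : 0 < c := by rw [hc]; linarith
  set F : ℝ → ℂ := fun u => -(WeilContinuous.moll 131 (u - c) + WeilContinuous.moll 131 (u + c))
    with hFdef
  set br : ℝ → ℝ := (WeilContinuous.bump 131).normed volume with hbr
  have hmoll : ∀ x : ℝ, WeilContinuous.moll 131 x = ((br x : ℝ) : ℂ) := fun x => rfl
  have hF : IsWeilTest F := isWeilTest_negTwoBump 131 c
  -- the hypotheses of the mutated statement at `a = c`
  have hsupp : tsupport F ⊆ Set.Icc (-(2 * c)) (2 * c) := by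
    refine closure_minimal (fun u hu => ?_) isClosed_Icc
    rw [Function.mem_support] at hu
    by_contra hu'
    refine hu (negHighTwoBump_eq_zero (Or.inr ?_))
    rw [mem_Icc, not_and_or, not_le, not_le] at hu'
    rcases hu' with h' | h'
    · calc 5 * Real.log 2 + 3 / 132 ≤ -u := by rw [hc] at h'; linarith
        _ ≤ |u| := neg_le_abs u
    · calc 5 * Real.log 2 + 3 / 132 ≤ u := by rw [hc] at h'; linarith
        _ ≤ |u| := le_abs_self u
  have heven : ∀ u : ℝ, F (-u) = F u := by
    intro u
    simp only [hFdef]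
    rw [show -u - c = -(u + c) by ring, show -u + c = -(u - c) by ring, moll_neg, moll_neg, add_comm]
  have hreal : ∀ u : ℝ, (starRingEnd ℂ) (F u) = F u := by
    intro u
    simp only [hFdef, map_neg, map_add, conj_moll]
  have hherm : ∀ u : ℝ, F (-u) = (starRingEnd ℂ) (F u) := fun u => by rw [heven, hreal]
  have hnodes : ∀ n : ℕ, 2 ≤ n → 0 ≤ (F (Real.log n)).re := by
    intro n hn
    simp only [hFdef, hc, negHighTwoBump_log_nat_eq_zero hn, Complex.zero_re, le_refl]
  -- where the witness can be non-zero: `5 log 2 + 1/132 < |t| < 5 log 2 + 3/132`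
  have hnz : ∀ t : ℝ, F t ≠ 0 → 5 * Real.log 2 + 1 / 132 < |t| ∧ |t| < 5 * Real.log 2 + 3 / 132 := by
    intro t ht
    by_contra hcon
    refine ht ?_
    simp only [hFdef, hc]
    refine negHighTwoBump_eq_zero ?_
    rcases not_and_or.1 hcon with h1 | h1
    · exact Or.inl (not_lt.1 h1)
    · exact Or.inr (not_lt.1 h1)
  have hwin : ∃ T : ℝ, 3 ≤ T ∧ ∀ t : ℝ, Real.log 2 ≤ |t| → (F t).re < 0 → T ≤ |t| ∧ |t| ≤ T + Real.log 2 := by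
    refine ⟨5 * Real.log 2, by linarith, fun t _ hneg => ?_⟩
    have hne : F t ≠ 0 := fun h0 => by rw [h0, Complex.zero_re] at hneg; exact lt_irrefl _ hneg
    have hb := hnz t hne
    constructor <;> linarith [hb.1, hb.2]
  have h2c : WeilContinuous.moll 131 (c + c) = 0 :=
    moll131_eq_zero (by rw [abs_of_pos (by linarith)]; rw [hc]; linarith)
  have hosc : ∃ t : ℝ, Real.log 2 ≤ |t| ∧ (F t).re < 0 := by
    refine ⟨c, by rw [abs_of_pos hcpos, hc]; linarith, ?_⟩
    simp only [hFdef, sub_self, h2c, add_zero, Complex.neg_re, neg_lt_zero]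
    exact re_moll_zero_pos 131
  have hc0 : WeilContinuous.moll 131 (0 + c) = 0 :=
    moll131_eq_zero (by rw [zero_add, abs_of_pos hcpos, hc]; linarith)
  have hF0 : F 0 = 0 := by
    have h1 : WeilContinuous.moll 131 (0 - c) = 0 := by
      rw [show (0 : ℝ) - c = -(0 + c) by ring, moll_neg]; exact hc0
    simp only [hFdef, h1, hc0, add_zero, neg_zero]
  refine ⟨c, F, hcpos, ⟨hF, hsupp⟩, hherm, hnodes, hwin, hosc, hF0, ?_⟩
  -- it remains to show `Re W_ar(F) < 0`
  have hbr_nn : ∀ x, 0 ≤ br x := fun x => (WeilContinuous.bump 131).nonneg_normed x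
  have hbr_cont : Continuous br := (WeilContinuous.bump 131).continuous_normed
  have hbr_int1 : ∫ x, br x = 1 := (WeilContinuous.bump 131).integral_normed
  have hbr_zero : ∀ {x : ℝ}, 1 / 132 ≤ |x| → br x = 0 := fun {x} hx => by
    have := moll131_eq_zero hx
    rwa [hmoll, Complex.ofReal_eq_zero] at this
  /- (1) the polar term: `Re (F̂(0) + F̂(1)) = ∫ F (e^{-t/2} + e^{t/2}) ≤ ∫ 2F = -4` -/
  have hpolar : (weilPolarTerm F).re ≤ -4 := by
    have hI := fun s : ℂ => integrable_weilIntegrand hF.1.continuous hF.2 s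
    have e1 : weilPolarTerm F = ∫ t : ℝ, F t * (cexp ((0 - 1 / 2) * t) + cexp ((1 - 1 / 2) * t)) := by
      unfold weilPolarTerm weilMellin
      rw [← integral_add (hI 0) (hI 1)]
      congr 1 with t
      ring
    have hpt : ∀ t : ℝ, F t * (cexp ((0 - 1 / 2) * t) + cexp ((1 - 1 / 2) * t)) =
        (((-(br (t - c) + br (t + c))) * (Real.exp (-(t / 2)) + Real.exp (t / 2)) : ℝ) : ℂ) := by
      intro t
      have ea : cexp ((0 - 1 / 2) * (t : ℂ)) = ((Real.exp (-(t / 2)) : ℝ) : ℂ) := by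
        rw [Complex.ofReal_exp]; congr 1; push_cast; ring
      have eb : cexp ((1 - 1 / 2) * (t : ℂ)) = ((Real.exp (t / 2) : ℝ) : ℂ) := by
        rw [Complex.ofReal_exp]; congr 1; push_cast; ring
      rw [ea, eb]
      simp only [hFdef, hmoll]
      push_cast
      ring
    have e2 : (weilPolarTerm F).re =
        ∫ t : ℝ, (-(br (t - c) + br (t + c))) * (Real.exp (-(t / 2)) + Real.exp (t / 2)) := by
      rw [e1]
      simp_rw [hpt]
      rw [integral_complex_ofReal, Complex.ofReal_re]
    rw [e2]
    have hle : ∀ t : ℝ, (-(br (t - c) + br (t + c))) * (Real.exp (-(t / 2)) + Real.exp (t / 2)) ≤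
        -2 * (br (t - c) + br (t + c)) := by
      intro t
      have hsum : 0 ≤ br (t - c) + br (t + c) := add_nonneg (hbr_nn _) (hbr_nn _)
      have hcosh : 2 ≤ Real.exp (-(t / 2)) + Real.exp (t / 2) := by
        have h1 := Real.one_le_cosh (t / 2)
        rw [Real.cosh_eq] at h1
        linarith
      nlinarith
    have hint_br : ∀ d : ℝ, Integrable fun t : ℝ => br (t + d) := fun d =>
      (WeilContinuous.bump 131).integrable_normed.comp_add_right d
    have hint_rhs : Integrable fun t : ℝ => -2 * (br (t - c) + br (t + c)) := by
      have := ((hint_br (-c)).add (hint_br c)).const_mul (-2)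
      refine this.congr (Eventually.of_forall fun t => ?_)
      simp only [Pi.add_apply, sub_eq_add_neg]
    have hint_lhs : Integrable fun t : ℝ =>
        (-(br (t - c) + br (t + c))) * (Real.exp (-(t / 2)) + Real.exp (t / 2)) := by
      refine Continuous.integrable_of_hasCompactSupport (by fun_prop) ?_
      refine HasCompactSupport.mul_right ?_
      refine HasCompactSupport.neg ?_
      exact ((WeilContinuous.bump 131).hasCompactSupport_normed.comp_homeomorph
          (Homeomorph.addRight (-c))).add
        ((WeilContinuous.bump 131).hasCompactSupport_normed.comp_homeomorph (Homeomorph.addRight c))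
    calc ∫ t : ℝ, (-(br (t - c) + br (t + c))) * (Real.exp (-(t / 2)) + Real.exp (t / 2))
        ≤ ∫ t : ℝ, -2 * (br (t - c) + br (t + c)) := integral_mono hint_lhs hint_rhs hle
      _ = -4 := by
          rw [integral_const_mul, integral_add ?_ (hint_br _), integral_add_right_eq_self (μ := volume) br,
            hbr_int1]
          · have := integral_sub_right_eq_self (μ := (volume : Measure ℝ)) br c
            rw [this, hbr_int1]; norm_num
          · have := hint_br (-c)
            simpa only [sub_eq_add_neg] using this
  /- (2) the archimedean term in Bombieri's form: `Re W_∞(F) = ∫₀^∞ e^{t/2} φ(t - c)/sinh t ≤ e²/3` -/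
  have harch : (weilArchTerm F).re ≤ Real.exp 1 * Real.exp 1 / 3 := by
    rw [← weilArchTermBombieri_eq_weilArchTerm_holds hF, weilArchTermBombieri_eq, hF0]
    have hint_eq : ∀ t ∈ Ioi (0 : ℝ),
        ((Real.exp (t / 2) : ℂ) * (F t + F (-t)) - 2 * (0 : ℂ)) / (2 * Real.sinh t : ℂ) =
          ((-(Real.exp (t / 2) * br (t - c) / Real.sinh t) : ℝ) : ℂ) := by
      intro t ht
      have ht0 : 0 < t := ht
      have hp : br (t + c) = 0 := hbr_zero (by rw [abs_of_pos (by linarith)]; rw [hc]; linarith)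
      have hs : (Real.sinh t : ℂ) ≠ 0 := by exact_mod_cast (Real.sinh_pos_iff.2 ht0).ne'
      rw [heven t]
      simp only [hFdef, hmoll, hp]
      push_cast
      field_simp
      ring
    rw [setIntegral_congr_fun measurableSet_Ioi hint_eq, integral_complex_ofReal]
    simp only [mul_zero, zero_sub, Complex.neg_re, Complex.ofReal_re, integral_neg, neg_neg]
    -- pointwise bound of the (everywhere non-negative) integrand
    set K : ℝ := Real.exp 1 * Real.exp 1 / 3 with hK
    have hKpos : 0 < K := by positivity
    have hexp2 : Real.exp 2 = Real.exp 1 * Real.exp 1 := by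
      rw [← Real.exp_add]; norm_num
    have hpw : ∀ t : ℝ, Real.exp (t / 2) * br (t - c) / Real.sinh t ≤ K * br (t - c) := by
      intro t
      by_cases hb : br (t - c) = 0
      · simp [hb]
      · have ht : |t - c| < 1 / 132 := by
          by_contra hh; exact hb (hbr_zero (not_lt.1 hh))
        rw [abs_lt] at ht
        have ht3 : 3 ≤ t := by rw [hc] at ht; linarith [ht.1]
        have hsinh : 3 ≤ Real.sinh t := ht3.trans (Real.self_le_sinh_iff.2 (by linarith))
        have hsinh_pos : 0 < Real.sinh t := by linarith
        have hexp : Real.exp (t / 2) ≤ Real.exp 1 * Real.exp 1 := by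
          rw [← hexp2]
          exact Real.exp_le_exp.2 (by rw [hc] at ht; linarith [ht.2])
        rw [div_le_iff₀ hsinh_pos]
        calc Real.exp (t / 2) * br (t - c) ≤ Real.exp 1 * Real.exp 1 * br (t - c) :=
              mul_le_mul_of_nonneg_right hexp (hbr_nn _)
          _ = K * br (t - c) * 3 := by rw [hK]; ring
          _ ≤ K * br (t - c) * Real.sinh t :=
              mul_le_mul_of_nonneg_left hsinh (mul_nonneg hKpos.le (hbr_nn _))
    have hnn : ∀ t : ℝ, 0 ≤ Real.exp (t / 2) * br (t - c) / Real.sinh t := by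
      intro t
      by_cases hb : br (t - c) = 0
      · simp [hb]
      · have ht : |t - c| < 1 / 132 := by
          by_contra hh; exact hb (hbr_zero (not_lt.1 hh))
        rw [abs_lt] at ht
        have hsinh : 0 < Real.sinh t := Real.sinh_pos_iff.2 (by rw [hc] at ht; linarith [ht.1])
        exact div_nonneg (mul_nonneg (Real.exp_pos _).le (hbr_nn _)) hsinh.le
    have hint_br : Integrable fun t : ℝ => br (t - c) := by
      have : Integrable fun t : ℝ => br (t + -c) :=
        (WeilContinuous.bump 131).integrable_normed.comp_add_right (-c)
      simpa only [sub_eq_add_neg] using this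
    calc ∫ t in Ioi (0 : ℝ), Real.exp (t / 2) * br (t - c) / Real.sinh t
        ≤ ∫ t in Ioi (0 : ℝ), K * br (t - c) :=
          integral_mono_of_nonneg (Eventually.of_forall hnn) (hint_br.const_mul K).integrableOn
            (Eventually.of_forall hpw)
      _ ≤ ∫ t : ℝ, K * br (t - c) :=
          setIntegral_le_integral (hint_br.const_mul K)
            (Eventually.of_forall fun t => mul_nonneg hKpos.le (hbr_nn _))
      _ = K := by
          rw [integral_const_mul, integral_sub_right_eq_self (μ := (volume : Measure ℝ)) br, hbr_int1, mul_one]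
  /- (3) conclusion: `Re W_ar(F) ≤ -4 + e²/3 < 0` -/
  have he : Real.exp 1 * Real.exp 1 / 3 < 4 := by
    have h1 := Real.exp_one_lt_d9
    have h0 : 0 < Real.exp 1 := Real.exp_pos 1
    nlinarith
  rw [Complex.add_re]
  linarith

/-! ## The main theorems -/

/-- **Positive-definiteness is load-bearing for `OscSingleWindow`.** The crux with its cone structure
"`F = Σᵢ gᵢ ⋆ g̃ᵢ`, `gᵢ` Weil tests supported in `[-a, a]`" replaced by "`F` a smooth, compactly supported
(in `[-2a, 2a]`), hermitian function" — node hypothesis, single-window hypothesis (`T ≥ 3`), oscillation hypothesis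
and conclusion verbatim — is false: witness `a = c = 5 log 2 + 1/66`, `F = -(φ(· - c) + φ(· + c))`,
`φ = WeilContinuous.moll 131`, window `T = 5 log 2` (`negHighTwoBump_witness`). [folklore] -/
theorem oscSingleWindow_false_without_PD :
    ¬ (∀ a : ℝ, 0 < a → ∀ F : ℝ → ℂ,
        (ContDiff ℝ ((⊤ : ℕ∞) : WithTop ℕ∞) F ∧ HasCompactSupport F) ∧ tsupport F ⊆ Set.Icc (-(2 * a)) (2 * a) →
        (∀ u : ℝ, F (-u) = (starRingEnd ℂ) (F u)) →
        (∀ n : ℕ, 2 ≤ n → 0 ≤ (F (Real.log n)).re) →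
        (∃ T : ℝ, 3 ≤ T ∧ ∀ t : ℝ, Real.log 2 ≤ |t| → (F t).re < 0 → T ≤ |t| ∧ |t| ≤ T + Real.log 2) →
        (∃ t : ℝ, Real.log 2 ≤ |t| ∧ (F t).re < 0) →
        let M : ℂ → ℂ := fun s => ∫ u : ℝ, F u * Complex.exp ((s - 1 / 2) * u);
        -(F 0).re ≤ (M 0 + M 1 + ((1 / (2 * Real.pi) : ℂ) * (∫ t : ℝ, M (1 / 2 + t * Complex.I) *
          ((Complex.digamma (1 / 4 + t / 2 * Complex.I)).re : ℂ)) - F 0 * (Real.log Real.pi : ℂ))).re) := by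
  intro h
  obtain ⟨a, F, ha, hF, hherm, hn, hw, hosc, hF0, hneg⟩ := negHighTwoBump_witness
  -- the mutated statement at the witness, in the Literature vocabulary (definitional unfolding)
  have key : -(F 0).re ≤ (weilPolarTerm F + weilArchTerm F).re := h a ha F hF hherm hn hw hosc
  rw [hF0, Complex.zero_re, neg_zero] at key
  linarith

/-- **…and no constant slack rescues it.** For every `C : ℝ`, the same PD-free single-window statement with
conclusion `-C·Re F(0) ≤ Re W_ar(F)` is false (the witness has `F(0) = 0`, so any multiple of `Re F(0)` is no
slack at all, while `Re W_ar(F) < 0`). [folklore] -/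
theorem oscSingleWindow_false_without_PD_anySlack (C : ℝ) :
    ¬ (∀ a : ℝ, 0 < a → ∀ F : ℝ → ℂ,
        (ContDiff ℝ ((⊤ : ℕ∞) : WithTop ℕ∞) F ∧ HasCompactSupport F) ∧ tsupport F ⊆ Set.Icc (-(2 * a)) (2 * a) →
        (∀ u : ℝ, F (-u) = (starRingEnd ℂ) (F u)) →
        (∀ n : ℕ, 2 ≤ n → 0 ≤ (F (Real.log n)).re) →
        (∃ T : ℝ, 3 ≤ T ∧ ∀ t : ℝ, Real.log 2 ≤ |t| → (F t).re < 0 → T ≤ |t| ∧ |t| ≤ T + Real.log 2) →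
        (∃ t : ℝ, Real.log 2 ≤ |t| ∧ (F t).re < 0) →
        let M : ℂ → ℂ := fun s => ∫ u : ℝ, F u * Complex.exp ((s - 1 / 2) * u);
        -(C * (F 0).re) ≤ (M 0 + M 1 + ((1 / (2 * Real.pi) : ℂ) * (∫ t : ℝ, M (1 / 2 + t * Complex.I) *
          ((Complex.digamma (1 / 4 + t / 2 * Complex.I)).re : ℂ)) - F 0 * (Real.log Real.pi : ℂ))).re) := by
  intro h
  obtain ⟨a, F, ha, hF, hherm, hn, hw, hosc, hF0, hneg⟩ := negHighTwoBump_witness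
  have key : -(C * (F 0).re) ≤ (weilPolarTerm F + weilArchTerm F).re := h a ha F hF hherm hn hw hosc
  rw [hF0, Complex.zero_re, mul_zero, neg_zero] at key
  linarith

end Summit.RiemannHypothesis.RiemannHypothesis.Theorems.OscSingleWindow.Negative

end
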